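import Summits.Parity.BatemanHorn.Theorems.RoughValueTransportDefs
import Summits.Parity.BatemanHorn.Theorems.BalancedSemiprimeLayer.Negative.LowerHalf
import Summits.Parity.BatemanHorn.Theorems.BalancedSemiprimeLayer.Negative.RelativeConsistency

/-!
# `BalancedSemiprimeLayer` (crux stmt-Parity-9469): every coordinate layer statement — in particular
# the line's residual stub `stub_higherLayer` (= the route's foreseen `LayerHigher`) — is NECESSARY

Negative-side structural lemmas (drefute gen 3, refuter-drefute-stmt-Parity-9469-g3-0), PROVED.
The line `smooth-modulus-twisted-hooley` closes the crux from its stubs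
(`Cruxes/BalancedSemiprimeLayer/Lines/smooth-modulus-twisted-hooley.lean`,
`balancedSemiprimeLayer_of_parts`); all stubs but `stub_higherLayer` (coordinates of degree `≥ 3`)
are landed or landing.  Here the CONVERSE direction: the crux's conclusion for a family `f`
(positive leading coefficients, degrees `≥ 1`) implies `CoordLayerThin f i` for EVERY coordinate
`i` (`coordLayerThin_of_cruxConclusion`): the layer of coordinate `i` and the all-prime part of the
crux's count are disjoint inside that count (`coordLayer_add_card_allPrime_le`), and the all-prime
part is at least `P_f(x) − K − k(2√x + 1)` (`polyPrimeCount_le_card_allPrime_add`, the refinement of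
`Negative.polyPrimeCount_le_cruxCount_add` to the all-prime sub-count).  Consequences:

* `coordLayerThin_of_balancedSemiprimeLayer`, `higherLayer_of_balancedSemiprimeLayer`: the crux
  implies the residual stub's statement verbatim — so, given the landed stubs, the crux and
  `LayerHigher` are EQUIVALENT (promoting the stub loses nothing), and
* `not_balancedSemiprimeLayer_of_not_coordLayerThin`: ONE Bateman–Horn system with ONE fat
  coordinate layer refutes the crux (the refuter's target for `LayerHigher` is the crux itself);
* `coordLayerThin_of_roughValueLaw_of_sieveCalibration_of_batemanHorn`: relative consistency of
  every coordinate layer statement (hence of `stub_higherLayer`) modulo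
  `RoughValueLaw ∧ SieveCalibration ∧ BatemanHorn`, from `Negative.RelativeConsistency` — a
  refutation of `LayerHigher` would be an anti-Bateman–Horn phenomenon (or a failure of the Buchstab
  shape of rough values); moreover any counterexample exhibits, for every `δ > 0` and infinitely many
  `x`, an `n ≤ x` with a prime factor of `fᵢ(n)` of size `≥ x^{deg fᵢ(1−δ)/2}`, i.e.
  `P⁺(∏_{n ≤ x} fᵢ(n)) ≥ x^{deg fᵢ/2 − o(1)}` infinitely often — far beyond what is known for any
  polynomial of degree `≥ 2` (Erdős–Schinzel problem; Tenenbaum 1990: `> x·exp((log x)^α)`).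
-/

namespace Summit.Parity.BatemanHorn.Theorems.BalancedSemiprimeLayer.Negative

open Filter Finset Polynomial Real Asymptotics
open scoped Topology
open Literature.NumberTheory.Sieve
open Summit.Parity.BatemanHorn.Theses.RoughValueTransport
open Summit.Parity.BatemanHorn.Cruxes.BalancedSemiprimeLayer.SmoothModulusTwistedHooley
  (coordLayer CoordLayerThin)

/-- **The crux's count splits**: the layer of coordinate `i` (jointly rough, `fᵢ(n)` not prime) and
the all-prime part (jointly rough, every `fⱼ(n)` prime) are disjoint parts of the crux's count
`Φ_f(x, δ)`. [folklore] -/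
theorem coordLayer_add_card_allPrime_le {k : ℕ} (f : Fin k → ℤ[X]) (i : Fin k) (δ : ℝ) (x : ℕ) :
    coordLayer f i δ x +
      #((Icc 1 x).filter (fun n : ℕ => (∀ j, 0 < (f j).eval (n : ℤ) ∧
        ∀ p ∈ range ⌈(x : ℝ) ^ (((f j).natDegree : ℝ) * (1 - δ) / 2)⌉₊,
          p.Prime → ¬ ((p : ℤ) ∣ (f j).eval (n : ℤ))) ∧ ∀ j, ((f j).eval (n : ℤ)).toNat.Prime)) ≤
      #((Icc 1 x).filter (fun n : ℕ => ∀ j, 0 < (f j).eval (n : ℤ) ∧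
        ∀ p ∈ range ⌈(x : ℝ) ^ (((f j).natDegree : ℝ) * (1 - δ) / 2)⌉₊,
          p.Prime → ¬ ((p : ℤ) ∣ (f j).eval (n : ℤ)))) := by
  unfold coordLayer
  rw [← card_union_of_disjoint]
  · refine card_le_card fun n hn => ?_
    rw [mem_union] at hn
    rw [mem_filter]
    rcases hn with hn | hn
    · rw [mem_filter] at hn
      exact ⟨hn.1, hn.2.1⟩
    · rw [mem_filter] at hn
      exact ⟨hn.1, hn.2.1⟩
  · rw [disjoint_left]
    intro n hn1 hn2
    rw [mem_filter] at hn1 hn2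
    exact hn1.2.2 (hn2.2.2 i)

/-- **The all-prime part of the crux's count is at least `P_f(x) − K − k(2√x + 1)`** (refinement of
`polyPrimeCount_le_cruxCount_add` to the all-prime sub-count; same proof): an `n ≤ x` all of whose
values are prime is jointly rough unless `n = 0` or some prime value `fⱼ(n)` lies below its sifting
range `x^{deg fⱼ(1−δ)/2} ≤ x^{deg fⱼ/2}`, which forces `n ≤ 2√x` past a threshold depending on `fⱼ`.
[folklore] -/
theorem polyPrimeCount_le_card_allPrime_add {k : ℕ} (f : Fin k → ℤ[X])
    (hlc : ∀ i, 0 < (f i).leadingCoeff) (hdeg : ∀ i, 0 < (f i).natDegree) {δ : ℝ} (hδ0 : 0 ≤ δ) :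
    ∃ K : ℝ, ∀ x : ℕ, (polyPrimeCount f x : ℝ) ≤
      #((Icc 1 x).filter (fun n : ℕ => (∀ i, 0 < (f i).eval (n : ℤ) ∧
        ∀ p ∈ range ⌈(x : ℝ) ^ (((f i).natDegree : ℝ) * (1 - δ) / 2)⌉₊,
          p.Prime → ¬ ((p : ℤ) ∣ (f i).eval (n : ℤ))) ∧ ∀ i, ((f i).eval (n : ℤ)).toNat.Prime)) +
        K + k * (2 * Real.sqrt x + 1) := by
  choose M hM using fun i => exists_pow_le_two_mul_eval (hlc i)
  refine ⟨1 + ∑ i, (M i : ℝ), fun x => ?_⟩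
  -- the sets
  set SP : Finset ℕ := (range (x + 1)).filter (fun n : ℕ =>
    ∀ i, 0 < (f i).eval (n : ℤ) ∧ ((f i).eval (n : ℤ)).toNat.Prime) with hSP
  set T : Finset ℕ := SP.filter (fun n : ℕ => 1 ≤ n ∧
    ∀ i, (x : ℝ) ^ (((f i).natDegree : ℝ) * (1 - δ) / 2) ≤ (((f i).eval (n : ℤ) : ℤ) : ℝ)) with hT
  set B : Fin k → Finset ℕ := fun i => SP.filter (fun n : ℕ =>
    (((f i).eval (n : ℤ) : ℤ) : ℝ) < (x : ℝ) ^ (((f i).natDegree : ℝ) * (1 - δ) / 2)) with hB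
  have hPdef : polyPrimeCount f x = #SP := by
    rw [hSP]
    unfold polyPrimeCount
    congr
  -- (1) `T ⊆` the all-prime part of the crux filter
  have hTsub : T ⊆ (Icc 1 x).filter (fun n : ℕ => (∀ i, 0 < (f i).eval (n : ℤ) ∧
      ∀ p ∈ range ⌈(x : ℝ) ^ (((f i).natDegree : ℝ) * (1 - δ) / 2)⌉₊,
        p.Prime → ¬ ((p : ℤ) ∣ (f i).eval (n : ℤ))) ∧ ∀ i, ((f i).eval (n : ℤ)).toNat.Prime) := by
    intro n hn
    simp only [hT, hSP, mem_filter, mem_range] at hn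
    obtain ⟨⟨hnx, hprime⟩, hn1, hbig⟩ := hn
    simp only [mem_filter, mem_Icc]
    refine ⟨⟨hn1, by omega⟩, fun i => ⟨(hprime i).1, fun p hp hpp hdvd => ?_⟩, fun i => (hprime i).2⟩
    -- `p ∣ fᵢ(n)` prime with `fᵢ(n)` prime ⇒ `p = fᵢ(n) ≥ zᵢ`, contradicting `p < ⌈zᵢ⌉₊`
    have hpos := (hprime i).1
    have hq := (hprime i).2
    set q : ℕ := ((f i).eval (n : ℤ)).toNat with hq_def
    have hqz : (q : ℤ) = (f i).eval (n : ℤ) := Int.toNat_of_nonneg hpos.le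
    have hpq : p ∣ q := by
      rw [← hqz] at hdvd
      exact Int.natCast_dvd_natCast.mp hdvd
    have hpq' : p = q := ((Nat.dvd_prime hq).mp hpq).resolve_left hpp.ne_one
    have hlt : (p : ℝ) < (x : ℝ) ^ (((f i).natDegree : ℝ) * (1 - δ) / 2) :=
      Nat.lt_ceil.mp (mem_range.mp hp)
    have hge := hbig i
    rw [← hqz] at hge
    push_cast at hge
    rw [← hpq'] at hge
    linarith
  -- (2) `SP \ T ⊆ {0} ∪ ⋃ B i`
  have hdiff : SP \ T ⊆ {0} ∪ Finset.univ.biUnion B := by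
    intro n hn
    obtain ⟨hnS, hnT⟩ := Finset.mem_sdiff.mp hn
    rw [mem_union, mem_singleton, mem_biUnion]
    by_cases hn0 : n = 0
    · exact Or.inl hn0
    · right
      have : ¬ (1 ≤ n ∧ ∀ i, (x : ℝ) ^ (((f i).natDegree : ℝ) * (1 - δ) / 2) ≤
          (((f i).eval (n : ℤ) : ℤ) : ℝ)) := by
        intro h
        exact hnT (by simp only [hT, mem_filter]; exact ⟨hnS, h⟩)
      push Not at this
      obtain ⟨i, hi⟩ := this (by omega)
      exact ⟨i, mem_univ i, by simp only [hB, mem_filter]; exact ⟨hnS, hi⟩⟩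
  -- (3) `#(B i) ≤ M i + (2√x + 1)`
  have hBcard : ∀ i, (#(B i) : ℝ) ≤ M i + (2 * Real.sqrt x + 1) := by
    intro i
    have hsub : B i ⊆ range (M i) ∪ Iic ⌊2 * Real.sqrt x⌋₊ := by
      intro n hn
      simp only [hB, hSP, mem_filter, mem_range] at hn
      obtain ⟨⟨hnx, -⟩, hsmall⟩ := hn
      rw [mem_union, mem_range, mem_Iic]
      by_cases hMn : n < M i
      · exact Or.inl hMn
      · right
        push Not at hMn
        apply Nat.le_floor
        -- show `(n : ℝ) ≤ 2 √x`
        by_contra hlt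
        push Not at hlt
        have hsx : 0 ≤ Real.sqrt x := Real.sqrt_nonneg _
        have hn1 : 1 ≤ n := by
          by_contra h0
          push Not at h0
          have : n = 0 := by omega
          subst this
          simp at hlt
          linarith
        have hx1 : (1 : ℝ) ≤ x := by exact_mod_cast hn1.trans (by omega : n ≤ x)
        have hx0 : (0 : ℝ) ≤ x := by linarith
        set d := (f i).natDegree with hd
        have hd1 : 1 ≤ d := hdeg i
        -- `n^d ≤ 2 fᵢ(n) < 2 zᵢ ≤ 2 x^{d/2} = 2 (√x)^d ≤ (2√x)^d < n^d`
        have hA : ((n : ℝ)) ^ d ≤ 2 * (((f i).eval (n : ℤ) : ℤ) : ℝ) := by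
          exact_mod_cast hM i n hMn
        have hz : (x : ℝ) ^ ((d : ℝ) * (1 - δ) / 2) ≤ Real.sqrt x ^ d := by
          rw [Real.sqrt_eq_rpow, ← Real.rpow_natCast, ← Real.rpow_mul hx0]
          refine Real.rpow_le_rpow_of_exponent_le hx1 ?_
          have : (0 : ℝ) ≤ d := Nat.cast_nonneg d
          nlinarith
        have h2d : (2 : ℝ) * Real.sqrt x ^ d ≤ (2 * Real.sqrt x) ^ d := by
          rw [mul_pow]
          refine mul_le_mul_of_nonneg_right ?_ (pow_nonneg hsx d)
          calc (2 : ℝ) = 2 ^ 1 := by norm_num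
            _ ≤ 2 ^ d := pow_le_pow_right₀ (by norm_num) hd1
        have hnd : (2 * Real.sqrt x) ^ d < (n : ℝ) ^ d :=
          pow_lt_pow_left₀ hlt (by positivity) (by omega)
        linarith
    calc (#(B i) : ℝ) ≤ #(range (M i) ∪ Iic ⌊2 * Real.sqrt x⌋₊) := by
          exact_mod_cast card_le_card hsub
      _ ≤ #(range (M i)) + #(Iic ⌊2 * Real.sqrt x⌋₊) := by exact_mod_cast card_union_le _ _
      _ = M i + (⌊2 * Real.sqrt x⌋₊ + 1 : ℕ) := by rw [card_range, Nat.card_Iic]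
      _ ≤ M i + (2 * Real.sqrt x + 1) := by
          push_cast
          have := Nat.floor_le (show 0 ≤ 2 * Real.sqrt x by positivity)
          linarith
  -- (4) assemble
  have hcardSP : (#SP : ℝ) ≤ #T + (1 + ∑ i, (#(B i) : ℝ)) := by
    have h1 : #SP ≤ #(SP \ T) + #T := card_le_card_sdiff_add_card
    have h2 : #(SP \ T) ≤ #({0} ∪ Finset.univ.biUnion B) := card_le_card hdiff
    have h3 : #({0} ∪ Finset.univ.biUnion B) ≤ 1 + ∑ i, #(B i) :=
      (card_union_le _ _).trans (add_le_add (by simp) card_biUnion_le)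
    have h4 : (#SP : ℝ) ≤ #(SP \ T) + #T := by exact_mod_cast h1
    have h5 : (#(SP \ T) : ℝ) ≤ 1 + ∑ i, (#(B i) : ℝ) := by exact_mod_cast h2.trans h3
    linarith
  have hTcard : (#T : ℝ) ≤ #((Icc 1 x).filter (fun n : ℕ => (∀ i, 0 < (f i).eval (n : ℤ) ∧
      ∀ p ∈ range ⌈(x : ℝ) ^ (((f i).natDegree : ℝ) * (1 - δ) / 2)⌉₊,
        p.Prime → ¬ ((p : ℤ) ∣ (f i).eval (n : ℤ))) ∧ ∀ i, ((f i).eval (n : ℤ)).toNat.Prime)) := by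
    exact_mod_cast card_le_card hTsub
  have hsum : ∑ i, (#(B i) : ℝ) ≤ ∑ i, ((M i : ℝ) + (2 * Real.sqrt x + 1)) :=
    sum_le_sum fun i _ => hBcard i
  rw [sum_add_distrib, sum_const, card_univ, Fintype.card_fin, nsmul_eq_mul] at hsum
  rw [hPdef]
  linarith

/-- **The layer of coordinate `i` is at most the crux's excess plus `K + k(2√x + 1)`**:
`E_{f,i}(x, δ) ≤ Φ_f(x, δ) − P_f(x) + K + k(2√x + 1)`. [folklore] -/
theorem coordLayer_le_cruxExcess_add {k : ℕ} (f : Fin k → ℤ[X])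
    (hlc : ∀ i, 0 < (f i).leadingCoeff) (hdeg : ∀ i, 0 < (f i).natDegree) {δ : ℝ} (hδ0 : 0 ≤ δ) :
    ∃ K : ℝ, ∀ (i : Fin k) (x : ℕ), (coordLayer f i δ x : ℝ) ≤
      #((Icc 1 x).filter (fun n : ℕ => ∀ j, 0 < (f j).eval (n : ℤ) ∧
        ∀ p ∈ range ⌈(x : ℝ) ^ (((f j).natDegree : ℝ) * (1 - δ) / 2)⌉₊,
          p.Prime → ¬ ((p : ℤ) ∣ (f j).eval (n : ℤ)))) - (polyPrimeCount f x : ℝ) +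
        K + k * (2 * Real.sqrt x + 1) := by
  obtain ⟨K, hK⟩ := polyPrimeCount_le_card_allPrime_add f hlc hdeg hδ0
  refine ⟨K, fun i x => ?_⟩
  have h1 := coordLayer_add_card_allPrime_le f i δ x
  have h1' : (coordLayer f i δ x : ℝ) +
      (#((Icc 1 x).filter (fun n : ℕ => (∀ j, 0 < (f j).eval (n : ℤ) ∧
        ∀ p ∈ range ⌈(x : ℝ) ^ (((f j).natDegree : ℝ) * (1 - δ) / 2)⌉₊,
          p.Prime → ¬ ((p : ℤ) ∣ (f j).eval (n : ℤ))) ∧ ∀ j, ((f j).eval (n : ℤ)).toNat.Prime)) : ℝ) ≤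
      #((Icc 1 x).filter (fun n : ℕ => ∀ j, 0 < (f j).eval (n : ℤ) ∧
        ∀ p ∈ range ⌈(x : ℝ) ^ (((f j).natDegree : ℝ) * (1 - δ) / 2)⌉₊,
          p.Prime → ¬ ((p : ℤ) ∣ (f j).eval (n : ℤ)))) := by
    exact_mod_cast h1
  have h2 := hK x
  linarith

/-- `K + k(2√x + 1) ≤ ε·x/(log x)^k` eventually (`ε > 0`): the correction is `O(√x)`. [folklore] -/
theorem eventually_const_add_sqrt_le_mul_div_log_pow (K : ℝ) (k : ℕ) {ε : ℝ} (hε : 0 < ε) :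
    ∀ᶠ x : ℕ in atTop, K + k * (2 * Real.sqrt x + 1) ≤ ε * (x : ℝ) / Real.log x ^ k := by
  -- `(log x)^k = o(x^{1/2})` on `ℝ`, pulled back to `ℕ`
  have hlo : (fun x : ℝ => Real.log x ^ (k : ℝ)) =o[atTop] fun x : ℝ => x ^ ((1 : ℝ) / 2) :=
    isLittleO_log_rpow_rpow_atTop (k : ℝ) (by norm_num)
  have hK' : 0 < |K| + 3 * k + 1 := by positivity
  have hc : 0 < ε / (|K| + 3 * k + 1) := div_pos hε hK'
  have hbound := (hlo.def hc).filter_mono (f₁ := atTop) le_rfl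
  have hnat := tendsto_natCast_atTop_atTop.eventually hbound
  filter_upwards [hnat, eventually_gt_atTop 1] with x hx hx1
  have hx' : (1 : ℝ) < x := by exact_mod_cast hx1
  have hx0 : (0 : ℝ) < x := by linarith
  have hlog : 0 < Real.log x := Real.log_pos hx'
  have hpow : 0 < Real.log x ^ k := pow_pos hlog k
  have hsq : Real.sqrt x = (x : ℝ) ^ ((1 : ℝ) / 2) := Real.sqrt_eq_rpow _
  have hsq1 : 1 ≤ Real.sqrt x := by
    rw [show (1 : ℝ) = Real.sqrt 1 from Real.sqrt_one.symm]
    exact Real.sqrt_le_sqrt hx'.le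
  -- unpack the little-o bound: `(log x)^k ≤ c · √x`
  rw [Real.norm_of_nonneg (by positivity), Real.norm_of_nonneg (by positivity),
    Real.rpow_natCast, ← hsq] at hx
  -- LHS ≤ (|K| + 3k + 1) · √x
  have hL : K + k * (2 * Real.sqrt x + 1) ≤ (|K| + 3 * k + 1) * Real.sqrt x := by
    have h1 : K ≤ |K| * Real.sqrt x := by
      calc K ≤ |K| := le_abs_self K
        _ = |K| * 1 := (mul_one _).symm
        _ ≤ |K| * Real.sqrt x := mul_le_mul_of_nonneg_left hsq1 (abs_nonneg K)
    have h2 : (k : ℝ) * (2 * Real.sqrt x + 1) ≤ 3 * k * Real.sqrt x := by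
      have hk0 : (0 : ℝ) ≤ k := Nat.cast_nonneg k
      nlinarith
    have h3 : (0 : ℝ) ≤ Real.sqrt x := Real.sqrt_nonneg _
    nlinarith
  -- RHS: `ε x/(log x)^k ≥ ε x/(c √x) = (|K|+3k+1) √x`
  have hxsq : (x : ℝ) = Real.sqrt x * Real.sqrt x := (Real.mul_self_sqrt hx0.le).symm
  have hR : (|K| + 3 * k + 1) * Real.sqrt x ≤ ε * (x : ℝ) / Real.log x ^ k := by
    rw [le_div_iff₀ hpow]
    calc (|K| + 3 * k + 1) * Real.sqrt x * Real.log x ^ k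
        ≤ (|K| + 3 * k + 1) * Real.sqrt x * (ε / (|K| + 3 * k + 1) * Real.sqrt x) := by
          gcongr
      _ = ε * (Real.sqrt x * Real.sqrt x) := by field_simp
      _ = ε * (x : ℝ) := by rw [← hxsq]
  linarith

/-- **The crux's conclusion for `f` implies that EVERY coordinate layer of `f` is thin**
(for families with positive leading coefficients and degrees `≥ 1`): take `δ` from the crux at
`ε/2`; then `E_{f,i}(x,δ) ≤ (ε/2)x/(log x)^k + K + k(2√x+1) ≤ εx/(log x)^k` eventually. [folklore] -/
theorem coordLayerThin_of_cruxConclusion {k : ℕ} (f : Fin k → ℤ[X])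
    (hlc : ∀ i, 0 < (f i).leadingCoeff) (hdeg : ∀ i, 0 < (f i).natDegree)
    (h : ∀ ε : ℝ, 0 < ε → ∃ δ : ℝ, 0 < δ ∧ δ ≤ 1 / 4 ∧ ∀ᶠ x : ℕ in atTop,
      (((Icc 1 x).filter (fun n : ℕ => ∀ i, 0 < (f i).eval (n : ℤ) ∧
        ∀ p ∈ range ⌈(x : ℝ) ^ (((f i).natDegree : ℝ) * (1 - δ) / 2)⌉₊,
          p.Prime → ¬ ((p : ℤ) ∣ (f i).eval (n : ℤ)))).card : ℝ) ≤
        (polyPrimeCount f x : ℝ) + ε * (x : ℝ) / Real.log x ^ k) (i : Fin k) :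
    CoordLayerThin f i := by
  intro ε hε
  obtain ⟨δ, hδ0, hδ4, hev⟩ := h (ε / 2) (half_pos hε)
  obtain ⟨K, hK⟩ := coordLayer_le_cruxExcess_add f hlc hdeg hδ0.le
  refine ⟨δ, hδ0, hδ4, ?_⟩
  filter_upwards [hev, eventually_const_add_sqrt_le_mul_div_log_pow K k (half_pos hε)]
    with x hx hsq
  have h1 := hK i x
  have : (coordLayer f i δ x : ℝ) ≤ ε / 2 * x / Real.log x ^ k + ε / 2 * x / Real.log x ^ k := by
    linarith
  calc (coordLayer f i δ x : ℝ) ≤ ε / 2 * x / Real.log x ^ k + ε / 2 * x / Real.log x ^ k := this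
    _ = ε * x / Real.log x ^ k := by ring

/-- **The crux implies every coordinate layer statement** for Bateman–Horn systems. [folklore] -/
theorem coordLayerThin_of_balancedSemiprimeLayer (h : BalancedSemiprimeLayer)
    {k : ℕ} (f : Fin k → ℤ[X]) (hf : IsBatemanHornSystem f) (i : Fin k) : CoordLayerThin f i :=
  coordLayerThin_of_cruxConclusion f hf.leadingCoeff_pos (natDegree_pos_of_isBatemanHornSystem hf)
    (h k f hf) i

/-- **The residual stub is necessary**: `BalancedSemiprimeLayer` implies the statement of the line's
open stub `stub_higherLayer` (= the route's `LayerHigher`) verbatim; with the other stubs landed the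
two are equivalent. [folklore] -/
theorem higherLayer_of_balancedSemiprimeLayer (h : BalancedSemiprimeLayer) :
    ∀ (k : ℕ) (f : Fin k → ℤ[X]), IsBatemanHornSystem f →
      ∀ i : Fin k, 3 ≤ (f i).natDegree → CoordLayerThin f i :=
  fun _k f hf i _ => coordLayerThin_of_balancedSemiprimeLayer h f hf i

/-- **Conditional refutation template for the crux**: one Bateman–Horn system with one coordinate
whose layer is NOT thin refutes `BalancedSemiprimeLayer`. [folklore] -/
theorem not_balancedSemiprimeLayer_of_not_coordLayerThin {k : ℕ} {f : Fin k → ℤ[X]}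
    (hf : IsBatemanHornSystem f) {i : Fin k} (h : ¬ CoordLayerThin f i) :
    ¬ BalancedSemiprimeLayer :=
  fun hB => h (coordLayerThin_of_balancedSemiprimeLayer hB f hf i)

/-- **Relative consistency of every coordinate layer statement** (in particular of
`stub_higherLayer` / `LayerHigher`): `RoughValueLaw ∧ SieveCalibration ∧ BatemanHorn` imply
`CoordLayerThin f i` for every Bateman–Horn system and every coordinate — a refutation of the
residual stub refutes one of the three. [folklore] -/
theorem coordLayerThin_of_roughValueLaw_of_sieveCalibration_of_batemanHorn
    (hR : RoughValueLaw) (hS : SieveCalibration) (hB : _root_.BatemanHorn)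
    {k : ℕ} (f : Fin k → ℤ[X]) (hf : IsBatemanHornSystem f) (i : Fin k) : CoordLayerThin f i :=
  coordLayerThin_of_cruxConclusion f hf.leadingCoeff_pos (natDegree_pos_of_isBatemanHornSystem hf)
    (fun ε hε => cruxConclusion_of_roughValueLaw_of_sieveCalibration_of_batemanHorn hR hS hB f hf ε hε)
    i

end Summit.Parity.BatemanHorn.Theorems.BalancedSemiprimeLayer.Negative
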